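import Summits.CriticalPhenomena.Ising3DConformalLimit.Theorems.SubPtolemyFloor.Negative.ExponentCharacterisation
import Summits.CriticalPhenomena.Ising3DConformalLimit.Theorems.SubPtolemyInterlacingSubPtolemyFloorWallCostCertificate
import Literature.Probability.LatticeModels.CriticalTwoPointDCPLowerHolds
import Literature.Probability.LatticeModels.CriticalEtaUpperDCPProofs
import Literature.Probability.LatticeModels.PointwiseScalingLimitEtaExists
import HarnessLib

/-!
# The unconditional liminf floor with exponent `3/2` (crux `SubPtolemyFloor`, line `Sketch-plus-wall-quotient-ladder`)

What: a dividend of the line `Sketch-plus-wall-quotient-ladder` for the crux `SubPtolemyFloor`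
(item stmt-CriticalPhenomena-15703, route `SubPtolemyInterlacing`, r3). With
`g(n) := ⟨σ₀σ_{n e₁}⟩_{β_c(3)} = criticalTwoPoint 3 (n • e₁)`:

* `frequently_rpow_le_criticalTwoPoint_axis` — **for every `a > 3/2` there are infinitely many `n` with
  `n^{-a} ≤ g(n)`**, unconditionally: the LOWER axial exponent `liminf (-log g(n)/log n)` is at most `3/2`.
  This is the `η ≤ 1/2` bound of Duminil-Copin–Panis (2025, Thm 1.5) with the hypothesis "η exists" removed
  and the conclusion weakened to a subsequence: their Theorem 1.3 at `β_c` (in tree,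
  `dcp_criticalTwoPoint_axis_lower_holds`: `g(n)·(χ_{4n} + n Σ_{k≤2n} k g(k)) ≥ c₁`) is run against an
  EVENTUAL pointwise upper bound `g(n) ≤ n^{-(1+b)}` (`b > 1/2`) instead of the η-ansatz: such a bound spreads
  to all of `ℤ³` by the Messager–Miracle-Solé sandwich (`criticalTwoPoint_le_mul_norm_rpow_of_axis`), makes
  the denominator `≤ (1 + 872K) n^{2-b}` (`dcp_denominator_le`), and then `c₁ ≤ (1+872K) n^{1-2b} → 0`.
* `exists_ge_rpow_le_criticalTwoPoint_axis` — the same in `∀ N, ∃ n ≥ N` form.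
* `frequently_rpow_le_boxMag` — through the landed plus-wall decoupling S2 (`g(2n+2) ≤ M_n²`,
  `stub_plusWallDecoupling`): for every `s > 3/4`, infinitely often `n^{-s} ≤ M_n = ⟨σ₀⟩⁺_{Λ_n;β_c,0}`
  (the wired one-arm probability of critical FK-Ising in `d = 3`), unconditionally — the liminf form of the
  conditional `n^{-3/4+o(1)}` bound quoted in van Engelenburg–Garban–Panis–Severo (2025), eq. after Thm 1.1.

Why it matters for the crux. The route consumes `SubPtolemyFloor` only through a scaling limit, where a
liminf/subsequence floor is as good as a floor (route note ROUTE-NOTE-k1 of the crux ideation); this file is the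
best UNCONDITIONAL statement of that shape: exponent `3/2 + ε`. It does NOT reach the crux's threshold
`log₂(1+√2) = 1.2716 < 3/2` (`SubPtolemyFloorNegative.threshold_lt_three_halves`), and by the disprover's model
profile `n^{-3/2}` (`SubPtolemyFloorNegative.not_floor_modelProfile`) `3/2` is exactly where two-point
axiomatics + DCP stop: the residual engine of the line (`stub_wallCost`) must supply the rest.

Sources: H. Duminil-Copin, R. Panis, *New lower bounds for the (near) critical Ising and φ⁴ models'
two-point functions*, CMP 406 (2025) = arXiv:2404.05700, Theorems 1.3 and 1.5 [DuminilCopinPanis2025LowerBounds];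
D. van Engelenburg, C. Garban, R. Panis, F. Severo, arXiv:2510.23423, §1.1 (Tasaki's bound and its conditional
improvement in `d = 3`). Tree: `dcp_criticalTwoPoint_axis_lower_holds`, `dcp_denominator_le`,
`dcp_denominator_pos`, `criticalTwoPoint_axis_sandwich`, `twoPointPlus_criticalBeta_eq_twoPointFree_holds`,
`SubPtolemyFloorPlusWall.stub_plusWallDecoupling` (p130950).
-/

noncomputable section

namespace Summit.CriticalPhenomena.Ising3DConformalLimit.SubPtolemyFloorPlusWall

open Literature.Probability.LatticeModels Filter Set
open scoped Topology

/-! ## An eventual axial upper bound spreads to `ℤ³` -/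

/-- **MMS spreading.** If `⟨σ₀σ_{n e₁}⟩_{β_c(3)} ≤ n^{-s}` for all `n ≥ N` (`N ≥ 1`, `s ≥ 0`), then
`⟨σ₀σ_x⟩_{β_c(3)} ≤ N^s ‖x‖^{-s}` for every `x ≠ 0`: by the Messager–Miracle-Solé sandwich
`⟨σ₀σ_x⟩ ≤ ⟨σ₀σ_{‖x‖_∞ e₁}⟩` (`criticalTwoPoint_axis_sandwich`), and `⟨σ₀σ_x⟩ ≤ 1 ≤ (N/‖x‖)^s` inside
the box `‖x‖_∞ < N`. [cite: MessagerMiracleSoleJSP1977, main theorem (monotonicity of ⟨σ₀σ_x⟩ under reflections)] -/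
theorem criticalTwoPoint_le_mul_norm_rpow_of_axis {s : ℝ} (hs : 0 ≤ s) {N : ℕ} (hN : 1 ≤ N)
    (h : ∀ n : ℕ, N ≤ n → criticalTwoPoint 3 (Pi.single 0 (n : ℤ)) ≤ (n : ℝ) ^ (-s)) :
    ∀ x : Site 3, x ≠ 0 → criticalTwoPoint 3 x ≤ (N : ℝ) ^ s * ‖x‖ ^ (-s) := by
  intro x hx
  have hm0 : Site.supNorm x ≠ 0 := fun h0 => hx (Site.supNorm_eq_zero_iff.1 h0)
  have hm1 : 1 ≤ Site.supNorm x := Nat.one_le_iff_ne_zero.2 hm0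
  have hGle : criticalTwoPoint 3 x ≤ criticalTwoPoint 3 (Pi.single 0 (Site.supNorm x : ℤ)) :=
    (criticalTwoPoint_axis_sandwich hm1).2
  rw [Site.norm_eq_supNorm]
  have hmpos : (0 : ℝ) < Site.supNorm x := by exact_mod_cast hm1
  have hNpos : (0 : ℝ) < N := by exact_mod_cast hN
  have hN1 : (1 : ℝ) ≤ N := by exact_mod_cast hN
  rcases le_or_gt N (Site.supNorm x) with hle | hlt
  · calc criticalTwoPoint 3 x ≤ criticalTwoPoint 3 (Pi.single 0 (Site.supNorm x : ℤ)) := hGle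
      _ ≤ ((Site.supNorm x : ℕ) : ℝ) ^ (-s) := h _ hle
      _ = 1 * ((Site.supNorm x : ℕ) : ℝ) ^ (-s) := (one_mul _).symm
      _ ≤ (N : ℝ) ^ s * ((Site.supNorm x : ℕ) : ℝ) ^ (-s) :=
          mul_le_mul_of_nonneg_right (Real.one_le_rpow hN1 hs) (Real.rpow_nonneg hmpos.le _)
  · have h1 : (1 : ℝ) ≤ (N : ℝ) ^ s * ((Site.supNorm x : ℕ) : ℝ) ^ (-s) := by
      rw [Real.rpow_neg hmpos.le, ← div_eq_mul_inv, ← Real.div_rpow hNpos.le hmpos.le]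
      exact Real.one_le_rpow ((one_le_div hmpos).2 (by exact_mod_cast hlt.le)) hs
    exact (criticalTwoPoint_le_one' x).trans h1

/-! ## The liminf floor with exponent `3/2` -/

/-- **Unconditional liminf floor (DCP Theorem 1.5 without η-existence, subsequence form).** For every
`a > 3/2` there are infinitely many `n` with `n^{-a} ≤ ⟨σ₀σ_{n e₁}⟩_{β_c(3)}`. Proof: otherwise eventually
`g(n) ≤ n^{-(1+b)}` with `b = min(a, 7/4) - 1 ∈ (1/2, 3/4]`; spreading (`criticalTwoPoint_le_mul_norm_rpow_of_axis`)
gives `⟨σ₀σ_x⟩ ≤ K‖x‖^{-(1+b)}` on `ℤ³ ∖ 0`, hence the denominator of Duminil-Copin–Panis (1.9) is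
`≤ (1+872K) n^{2-b}` (`dcp_denominator_le`) and Theorem 1.3 (`dcp_criticalTwoPoint_axis_lower_holds`, free =
plus state at `β_c`) yields `c₁ ≤ g(n)·denominator ≤ (1+872K) n^{1-2b} → 0`, absurd.
[cite: DuminilCopinPanis2025LowerBounds, Theorem 1.3 and proof of Theorem 1.5 (arXiv p. 6)] -/
theorem frequently_rpow_le_criticalTwoPoint_axis :
    ∀ a : ℝ, 3 / 2 < a →
      ∃ᶠ n : ℕ in Filter.atTop, (n : ℝ) ^ (-a) ≤ criticalTwoPoint 3 ((n : ℤ) • (Pi.single 0 1 : Site 3)) := by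
  intro a ha
  simp only [zsmul_single_zero_one]
  by_contra H
  rw [Filter.not_frequently] at H
  -- the working exponent `1 + b = min a (7/4) ∈ (3/2, 7/4]`
  set b : ℝ := min a (7 / 4) - 1 with hb_def
  have hmin_lo : (3 / 2 : ℝ) < min a (7 / 4) := lt_min ha (by norm_num)
  have hmin_a : min a (7 / 4 : ℝ) ≤ a := min_le_left _ _
  have hmin_hi : min a (7 / 4 : ℝ) ≤ 7 / 4 := min_le_right _ _
  have hb_lo : 1 / 2 < b := by rw [hb_def]; linarith
  have hb_hi : b ≤ 3 / 4 := by rw [hb_def]; linarith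
  have hb0 : 0 ≤ 1 + b := by linarith
  -- eventually `g(n) ≤ n^{-(1+b)}`
  obtain ⟨N, hN⟩ := eventually_atTop.1 (H.and (eventually_ge_atTop 1))
  have hNax : ∀ n : ℕ, max N 1 ≤ n →
      criticalTwoPoint 3 (Pi.single 0 (n : ℤ)) ≤ (n : ℝ) ^ (-(1 + b)) := by
    intro n hn
    obtain ⟨h1, h2⟩ := hN n (le_of_max_le_left hn)
    have hn1 : (1 : ℝ) ≤ n := by exact_mod_cast h2
    exact (not_le.1 h1).le.trans
      (Real.rpow_le_rpow_of_exponent_le hn1 (by rw [hb_def]; linarith))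
  -- pass to the free state of the source and spread the bound to `ℤ³`
  have hGeq : ∀ x, criticalTwoPoint 3 x = twoPointFree 3 (criticalBeta 3) x :=
    twoPointPlus_criticalBeta_eq_twoPointFree_holds (d := 3) le_rfl
  have hM1 : 1 ≤ max N 1 := le_max_right N 1
  set K : ℝ := ((max N 1 : ℕ) : ℝ) ^ (1 + b) with hK_def
  have hK : 0 < K := Real.rpow_pos_of_pos (by exact_mod_cast hM1) _
  have hFle : ∀ x : Site 3, x ≠ 0 → twoPointFree 3 (criticalBeta 3) x ≤ K * ‖x‖ ^ (-(1 + b)) := by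
    intro x hx
    rw [← hGeq]
    exact criticalTwoPoint_le_mul_norm_rpow_of_axis hb0 hM1 hNax x hx
  have hF0 : twoPointFree 3 (criticalBeta 3) 0 = 1 := twoPointFree_zero 3 _
  have hFnn : ∀ x, 0 ≤ twoPointFree 3 (criticalBeta 3) x := fun x => by
    rw [← hGeq]; exact criticalTwoPoint_nonneg' x
  -- Theorem 1.3 at `β_c`, `d = 3`
  obtain ⟨c₁, hc₁, N₁, -, hmain⟩ := dcp_criticalTwoPoint_axis_lower_holds (d := 3) le_rfl
  -- `(1 + 872K) n^{1-2b} → 0`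
  have hlim : Tendsto (fun n : ℕ => (1 + 872 * K) * (n : ℝ) ^ (1 - 2 * b)) atTop (𝓝 0) := by
    have h1 : Tendsto (fun t : ℝ => t ^ (1 - 2 * b)) atTop (𝓝 0) := by
      have := tendsto_rpow_neg_atTop (y := 2 * b - 1) (by linarith)
      simpa only [neg_sub] using this
    have h2 : Tendsto (fun n : ℕ => (n : ℝ) ^ (1 - 2 * b)) atTop (𝓝 0) :=
      h1.comp tendsto_natCast_atTop_atTop
    simpa only [mul_zero] using h2.const_mul (1 + 872 * K)
  obtain ⟨n, hnlt, hnge⟩ :=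
    ((hlim.eventually (gt_mem_nhds hc₁)).and (eventually_ge_atTop (max N₁ (max N 1)))).exists
  have hnN : N₁ ≤ n := le_of_max_le_left hnge
  have hnM : max N 1 ≤ n := le_of_max_le_right hnge
  have hn1 : 1 ≤ n := le_of_max_le_right hnM
  have htpos : (0 : ℝ) < n := by exact_mod_cast hn1
  -- (1.9) at this `n`
  have h13 := hmain n hnN
  have e0 : (⟨0, by norm_num⟩ : Fin 3) = 0 := rfl
  rw [e0, show (3 - 2 : ℕ) = 1 from rfl, pow_one] at h13
  have hup : twoPointFree 3 (criticalBeta 3) (Pi.single 0 (n : ℤ)) ≤ (n : ℝ) ^ (-(1 + b)) := by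
    rw [← hGeq]; exact hNax n hnM
  have hDpos := dcp_denominator_pos hF0 hFnn (0 : Fin 3) n
  have hDle := dcp_denominator_le hK hb_lo hb_hi hF0 hFle (0 : Fin 3) hn1
  have hdiv := (div_le_iff₀ hDpos).1 (h13.trans hup)
  have hchain : c₁ ≤ (1 + 872 * K) * (n : ℝ) ^ (1 - 2 * b) := by
    calc c₁ ≤ (n : ℝ) ^ (-(1 + b)) * _ := hdiv
      _ ≤ (n : ℝ) ^ (-(1 + b)) * ((1 + 872 * K) * (n : ℝ) ^ (2 - b)) :=
          mul_le_mul_of_nonneg_left hDle (Real.rpow_nonneg htpos.le _)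
      _ = (1 + 872 * K) * ((n : ℝ) ^ (-(1 + b)) * (n : ℝ) ^ (2 - b)) := by ring
      _ = (1 + 872 * K) * (n : ℝ) ^ (1 - 2 * b) := by
          rw [← Real.rpow_add htpos, show -(1 + b) + (2 - b) = 1 - 2 * b by ring]
  linarith

/-- The same in `∀ N, ∃ n ≥ N` form: for every `a > 3/2` and every `N` there is `n ≥ N` with
`n^{-a} ≤ ⟨σ₀σ_{n e₁}⟩_{β_c(3)}` — a SUBSEQUENCE floor with any exponent above `3/2` (the shape the route
actually consumes, cf. the crux's route note; the crux asks for an all-`n` floor with exponent below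
`log₂(1+√2) < 3/2`, `SubPtolemyFloorNegative.threshold_lt_three_halves`). [cite: DuminilCopinPanis2025LowerBounds, Theorem 1.3 and Theorem 1.5] -/
theorem exists_ge_rpow_le_criticalTwoPoint_axis {a : ℝ} (ha : 3 / 2 < a) (N : ℕ) :
    ∃ n : ℕ, N ≤ n ∧ (n : ℝ) ^ (-a) ≤ criticalTwoPoint 3 ((n : ℤ) • (Pi.single 0 1 : Site 3)) :=
  Filter.frequently_atTop.1 (frequently_rpow_le_criticalTwoPoint_axis a ha) N

/-- Contrapositive form: no eventual strict upper bound `⟨σ₀σ_{n e₁}⟩_{β_c(3)} < n^{-a}` with `a > 3/2`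
(one-sided "`η(3) ≤ 1/2` along a subsequence", unconditionally). [cite: DuminilCopinPanis2025LowerBounds, Theorem 1.5] -/
theorem not_eventually_criticalTwoPoint_axis_lt_rpow {a : ℝ} (ha : 3 / 2 < a) :
    ¬ ∀ᶠ n : ℕ in atTop, criticalTwoPoint 3 ((n : ℤ) • (Pi.single 0 1 : Site 3)) < (n : ℝ) ^ (-a) := by
  rw [Filter.not_eventually]
  exact (frequently_rpow_le_criticalTwoPoint_axis a ha).mono fun n hn => not_lt.2 hn

/-! ## The one-point corollary through the plus-wall decoupling -/

/-- **Unconditional liminf one-arm bound with exponent `3/4`.** For every `s > 3/4`, infinitely often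
`n^{-s} ≤ ⟨σ₀⟩⁺_{Λ_n;β_c,0}` (`= φ¹_{Λ_n,β_c}[0 ↔ ∂Λ_n]`, the wired critical FK-Ising one-arm probability
in `d = 3`): from the liminf floor with exponent `a ∈ (3/2, 2s)` at a scale `m ≥ 4`, axial monotonicity
down to the even scale `2n+2 ∈ {m, m-1}` and the landed decoupling `⟨σ₀σ_{(2n+2)e₁}⟩ ≤ M_n²`
(`stub_plusWallDecoupling`, p130950). The all-`n` form with exponent `3/4 + o(1)` is known only
conditionally on η-existence (van Engelenburg–Garban–Panis–Severo 2025, §1.1); Tasaki's unconditional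
all-`n` bound is `c/n` (landed `boxMag_ge_inv`). [cite: VanEngelenburgGarbanPanisSevero2025, §1.1, the display after Thm. 1.1 (conditional n^{-3/4+o(1)})] -/
theorem frequently_rpow_le_boxMag :
    ∀ s : ℝ, 3 / 4 < s → ∃ᶠ n : ℕ in Filter.atTop, (n : ℝ) ^ (-s) ≤
      isingCorr (zdGraph 3) (box 3 n) (criticalBeta 3) 0 BoundaryCondition.plus {0} := by
  intro s hs
  -- an exponent strictly between `3/2` and `2s`
  set a : ℝ := (3 / 2 + 2 * s) / 2 with ha_def
  have ha : 3 / 2 < a := by rw [ha_def]; linarith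
  have has : a < 2 * s := by rw [ha_def]; linarith
  have hfreq := frequently_rpow_le_criticalTwoPoint_axis a ha
  simp only [zsmul_single_zero_one] at hfreq
  -- bookkeeping: for `m ≥ 4` put `n := (m-2)/2 ≥ 1`, so `2n+2 ≤ m ≤ 2n+3 ≤ 5n` and
  -- `m^{-a} ≥ (5n)^{-a} = 5^{-a} n^{-a}`; and eventually `5^{-a} n^{-a} ≥ n^{-2s}` (`a < 2s`).
  have hev : ∀ᶠ n : ℕ in atTop, (n : ℝ) ^ (-(2 * s)) ≤ (5 : ℝ) ^ (-a) * (n : ℝ) ^ (-a) := by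
    have hpos : 0 < 2 * s - a := by linarith
    have ht : Tendsto (fun n : ℕ => (n : ℝ) ^ (2 * s - a)) atTop atTop :=
      (tendsto_rpow_atTop hpos).comp tendsto_natCast_atTop_atTop
    filter_upwards [ht.eventually_ge_atTop ((5 : ℝ) ^ a), eventually_ge_atTop 1] with n hn hn1
    have hn0 : (0 : ℝ) < n := by exact_mod_cast hn1
    have hle : (n : ℝ) ^ (-(2 * s - a)) ≤ (5 : ℝ) ^ (-a) := by
      rw [Real.rpow_neg hn0.le, Real.rpow_neg (by norm_num : (0:ℝ) ≤ 5)]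
      exact inv_anti₀ (Real.rpow_pos_of_pos (by norm_num) _) hn
    calc (n : ℝ) ^ (-(2 * s)) = (n : ℝ) ^ (-a) * (n : ℝ) ^ (-(2 * s - a)) := by
          rw [← Real.rpow_add hn0]; ring_nf
      _ ≤ (n : ℝ) ^ (-a) * (5 : ℝ) ^ (-a) :=
          mul_le_mul_of_nonneg_left hle (Real.rpow_nonneg hn0.le _)
      _ = (5 : ℝ) ^ (-a) * (n : ℝ) ^ (-a) := mul_comm _ _
  obtain ⟨N₀, hN₀⟩ := eventually_atTop.1 hev
  rw [Filter.frequently_atTop]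
  intro N
  obtain ⟨m, hm, hgm⟩ := Filter.frequently_atTop.1 hfreq (max (2 * max N N₀ + 2) 4)
  -- the even scale below `m`
  set n : ℕ := (m - 2) / 2 with hn_def
  have hm4 : 4 ≤ m := le_of_max_le_right hm
  have hmN : 2 * max N N₀ + 2 ≤ m := le_of_max_le_left hm
  have hn_lo : 2 * n + 2 ≤ m := by omega
  have hn_hi : m ≤ 2 * n + 3 := by omega
  have hnN : N ≤ n := by omega
  have hnN₀ : N₀ ≤ n := by omega
  have hn1 : 1 ≤ n := by omega
  refine ⟨n, hnN, ?_⟩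
  have hn0 : (0 : ℝ) < n := by exact_mod_cast hn1
  have hm0 : (0 : ℝ) < m := by exact_mod_cast (by omega : 0 < m)
  -- `g(2n+2) ≥ g(m) ≥ m^{-a} ≥ (5n)^{-a} = 5^{-a} n^{-a} ≥ n^{-2s}`
  have hmono : criticalTwoPoint 3 (Pi.single 0 (m : ℤ)) ≤
      criticalTwoPoint 3 (Pi.single 0 ((2 * n + 2 : ℕ) : ℤ)) := criticalTwoPoint_axis_antitone hn_lo
  have hm_le : (m : ℝ) ≤ 5 * n := by
    have h53 : m ≤ 5 * n := by omega
    exact_mod_cast h53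
  have hpow : (5 : ℝ) ^ (-a) * (n : ℝ) ^ (-a) ≤ (m : ℝ) ^ (-a) := by
    rw [← Real.mul_rpow (by norm_num) hn0.le]
    exact Real.rpow_le_rpow_of_nonpos hm0 hm_le (by linarith)
  have hdec := stub_plusWallDecoupling n hn1
  have hsq : (n : ℝ) ^ (-(2 * s)) ≤
      isingCorr (zdGraph 3) (box 3 n) (criticalBeta 3) 0 BoundaryCondition.plus {0} ^ 2 :=
    calc (n : ℝ) ^ (-(2 * s)) ≤ (5 : ℝ) ^ (-a) * (n : ℝ) ^ (-a) := hN₀ n hnN₀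
      _ ≤ (m : ℝ) ^ (-a) := hpow
      _ ≤ criticalTwoPoint 3 (Pi.single 0 (m : ℤ)) := hgm
      _ ≤ criticalTwoPoint 3 (Pi.single 0 ((2 * n + 2 : ℕ) : ℤ)) := hmono
      _ ≤ isingCorr (zdGraph 3) (box 3 n) (criticalBeta 3) 0 BoundaryCondition.plus {0} ^ 2 := by
          simpa only [zsmul_single_zero_one] using hdec
  have hns : ((n : ℝ) ^ (-s)) ^ 2 = (n : ℝ) ^ (-(2 * s)) := by
    rw [← Real.rpow_natCast, ← Real.rpow_mul hn0.le]
    norm_num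
    ring_nf
  rw [← hns] at hsq
  exact (pow_le_pow_iff_left₀ (Real.rpow_nonneg hn0.le _) (boxMag_nonneg n) two_ne_zero).1 hsq

end Summit.CriticalPhenomena.Ising3DConformalLimit.SubPtolemyFloorPlusWall

end
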